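import Mathlib

/-!
# `SectionCriterion` (stmt-ResolutionOfSingularities-15962), helper: an abstract local isomorphism `B'_P ≅ R/(x)`

Route `ResolutionOfSingularities/SectionAscent`, support item `SectionCriterion`.
`exists_localization_ringEquiv_quotient`: for a surjection `Θ' : C' → B'` and a map `η : C' → R` to a
local ring with `x ∈ 𝔪_R` such that `ker Θ'` dies in `R/(x)`, every element of `R` is a fraction
`η(c)/η(u)`, and what `η` sends into `(x)` is killed by `Θ'` up to such units, the localisation of `B'`
at the pull-back of `𝔪_R` is isomorphic to `R/(x)`. Used to identify the local ring of the strict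
transform of the generic member with `𝒪/(x₁)`.

Proved by the wave-1 stub-worker of line `registered` of crux `GenericLevel` (stmt-…-15959); sorry-free,
no named facts. [folklore]
-/

set_option linter.dupNamespace false

open IsLocalRing

namespace Summit.ResolutionOfSingularities.ResolutionOfSingularities.Theorems

/-- **Reading a local ring of a quotient `B' = C'/ker Θ'` as `R/(x)`.** Let `Θ' : C' → B'` be
surjective and `η : C' → R` a homomorphism to a local ring, `x ∈ 𝔪_R`, such that (1) `ker Θ'`
dies in `R/(x)`, (2) every element of `R` is `η(c)/η(u)` with `η(u)` a unit, and (3) whatever `η`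
sends into `(x)` is killed by `Θ'` after multiplication by some `u` with `η(u)` a unit. Then for
the prime `P = β⁻¹(𝔪)` of `B'`, `β : B' → R/(x)` the induced map, `B'_P ≅ R/(x)`. [folklore] -/
theorem exists_localization_ringEquiv_quotient {C' B' R : Type*} [CommRing C'] [CommRing B']
    [CommRing R] [IsLocalRing R] (Θ' : C' →+* B') (hΘ' : Function.Surjective Θ')
    (η : C' →+* R) {x : R} (hx : x ∈ maximalIdeal R)
    (h1 : ∀ c, Θ' c = 0 → η c ∈ Ideal.span {x})
    (h2 : ∀ r : R, ∃ c u : C', IsUnit (η u) ∧ r * η u = η c)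
    (h3 : ∀ c : C', η c ∈ Ideal.span {x} → ∃ u : C', IsUnit (η u) ∧ Θ' (u * c) = 0) :
    ∃ P : PrimeSpectrum B',
      Nonempty (Localization.AtPrime P.asIdeal ≃+* R ⧸ Ideal.span {x}) := by
  classical
  -- the quotient is a nontrivial local ring
  have hxtop : Ideal.span {x} ≠ ⊤ := fun h =>
    (maximalIdeal.isMaximal R).ne_top (top_le_iff.mp (h ▸ (Ideal.span_le.mpr
      (Set.singleton_subset_iff.mpr hx))))
  haveI : Nontrivial (R ⧸ Ideal.span {x}) := Ideal.Quotient.nontrivial_iff.mpr hxtop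
  haveI : IsLocalRing (R ⧸ Ideal.span {x}) :=
    IsLocalRing.of_surjective' (Ideal.Quotient.mk _) Ideal.Quotient.mk_surjective
  let π : R →+* R ⧸ Ideal.span {x} := Ideal.Quotient.mk _
  -- `β : B' → R/(x)`
  have hker : ∀ c ∈ RingHom.ker Θ', (π.comp η) c = 0 := fun c hc => by
    rw [RingHom.comp_apply, Ideal.Quotient.eq_zero_iff_mem]
    exact h1 c hc
  let β₀ : C' ⧸ RingHom.ker Θ' →+* R ⧸ Ideal.span {x} := Ideal.Quotient.lift _ (π.comp η) hker
  let e : C' ⧸ RingHom.ker Θ' ≃+* B' := RingHom.quotientKerEquivOfSurjective hΘ'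
  let β : B' →+* R ⧸ Ideal.span {x} := β₀.comp e.symm.toRingHom
  have hβ : ∀ c, β (Θ' c) = π (η c) := by
    intro c
    change β₀ (e.symm (Θ' c)) = _
    have : e.symm (Θ' c) = Ideal.Quotient.mk _ c := by
      apply e.injective
      rw [e.apply_symm_apply]
      rfl
    rw [this]
    rfl
  -- the prime `P = β⁻¹ 𝔪`
  let P : PrimeSpectrum B' := ⟨(maximalIdeal (R ⧸ Ideal.span {x})).comap β, inferInstance⟩
  have hP : ∀ b, b ∈ P.asIdeal ↔ β b ∈ maximalIdeal (R ⧸ Ideal.span {x}) := fun b => Iff.rfl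
  have hunit : ∀ b : P.asIdeal.primeCompl, IsUnit (β b) := fun b => by
    have hb : (b : B') ∉ P.asIdeal := b.2
    rw [hP, mem_maximalIdeal, mem_nonunits_iff, not_not] at hb
    exact hb
  let ρ : Localization.AtPrime P.asIdeal →+* R ⧸ Ideal.span {x} :=
    IsLocalization.lift (M := P.asIdeal.primeCompl) hunit
  have hρ : ∀ b, ρ (algebraMap B' _ b) = β b := fun b => IsLocalization.lift_eq hunit b
  refine ⟨P, ⟨RingEquiv.ofBijective ρ ⟨?_, ?_⟩⟩⟩
  · -- injective
    rw [injective_iff_map_eq_zero]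
    intro z hz
    obtain ⟨⟨b, w⟩, rfl⟩ := IsLocalization.mk'_surjective P.asIdeal.primeCompl z
    rw [IsLocalization.lift_mk'] at hz
    have hb : β b = 0 := (Units.mul_left_eq_zero _).mp hz
    obtain ⟨c, rfl⟩ := hΘ' b
    rw [hβ, Ideal.Quotient.eq_zero_iff_mem] at hb
    obtain ⟨u, hu, huc⟩ := h3 c hb
    have hΘu : Θ' u ∉ P.asIdeal := by
      rw [hP, hβ, mem_maximalIdeal, mem_nonunits_iff, not_not]
      exact hu.map π
    rw [IsLocalization.mk'_eq_zero_iff]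
    exact ⟨⟨Θ' u, hΘu⟩, by rw [← map_mul, huc]⟩
  · -- surjective
    intro r
    obtain ⟨r, rfl⟩ := Ideal.Quotient.mk_surjective r
    obtain ⟨c, u, hu, hru⟩ := h2 r
    have hΘu : Θ' u ∉ P.asIdeal := by
      rw [hP, hβ, mem_maximalIdeal, mem_nonunits_iff, not_not]
      exact hu.map π
    refine ⟨IsLocalization.mk' _ (Θ' c) (⟨Θ' u, hΘu⟩ : P.asIdeal.primeCompl), ?_⟩
    rw [IsLocalization.lift_mk']
    change β (Θ' c) * _ = _
    rw [Units.mul_inv_eq_iff_eq_mul]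
    change _ = π r * β (Θ' u)
    rw [hβ, hβ, ← map_mul, ← hru]

end Summit.ResolutionOfSingularities.ResolutionOfSingularities.Theorems
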